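import Mathlib
import Summits.Ventures.PercRepro2.Defs
import Summits.Ventures.PercRepro2.Independence
import Summits.Ventures.PercRepro2.Harris
import Summits.Ventures.PercRepro2.Graph
import Summits.Ventures.PercRepro2.Exploration
import Summits.Ventures.PercRepro2.Events
import Summits.Ventures.PercRepro2.FourFunctions
import Summits.Ventures.PercRepro2.Induced
import Summits.Ventures.PercRepro2.Frontier
import Summits.Ventures.PercRepro2.ObsIndependence
import Summits.Ventures.PercRepro2.BHK
import Summits.Ventures.PercRepro2.BHKEvents
import Summits.Ventures.PercRepro2.MultiSource
import Summits.Ventures.PercRepro2.OrderPreservation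
import Summits.Ventures.PercRepro2.SeedSet
import Summits.Ventures.PercRepro2.MultiSourceFun
import Summits.Ventures.PercRepro2.CrossRootT
import Summits.Ventures.PercRepro2.VdBKahn
import Summits.Ventures.PercRepro2.LemmaA
import Summits.Ventures.PercRepro2.GateDefs
import Summits.Ventures.PercRepro2.GateFrame
import Summits.Ventures.PercRepro2.GateSFrame
import Summits.Ventures.PercRepro2.GateDegenerate
import Summits.Ventures.PercRepro2.ContractDefs
import Summits.Ventures.PercRepro2.VTXDefs
import Summits.Ventures.PercRepro2.VTXSplitFrame

/-!
# (VTX) from the gates: `VTX_all ⟸ ConW_all` (blind cell PercRepro2, typer-1; lead g11 16:30:35Z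
"make VTX_all ↔ ConW_all formal (the product split between the z-edges and the H-edges)")

With the pinning identity and the independence of `N(z)` from the `H`-events
(`VTXSplitFrame`), every `G`-avoidance term of (VTX) averages the gate `W = N(z)` of `H`:
`P_p(delEvent z A ∩ R_T^G) = Σ_W P_p(N(z) = W) · P_{pinZ p}(A ∩ gateEvent s T W W)`
(`prob_delEvent_inter_avoid_eq_sum`), and the pure `H`-terms are `pinZ p`-probabilities. Hence the
(VTX) expression is `Σ_W P(N(z) = W) · Φ_W` with `Φ_W` the cleared `GateRow (pinZ p) s T a b W W`
expression:

* **`VTX_of_gateRow`**: `(∀ W, GateRow (pinZ p) ends s T a b W W) → VTX p ends z s T a b`;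
* **`VTX_of_ConW`**: the non-degenerate `W` (`s ∉ W`, `W ∩ T = ∅`, `W ≠ ∅`) are `ConW` at any
  representative (`Contract.avoidAll_contract_eq`: the contracted avoidance is the gate), the
  degenerate ones are `GateRow_empty_left`, `GateRow_of_root_mem` (Lemma A′) and
  `GateRow_of_T_mem` (Lemma A);
* **`VTX_all_of_ConW_all`**: `ConW_all R → VTX_all R`.

(The converse `ConW_all → VTX_all`'s reverse, `ConW` from `VTX` by attaching `z` to `W` with
weight-1 edges, needs a graph with a new vertex and is not formalised here.)
-/

namespace Summit.Ventures.PercRepro2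

namespace NewVertex

open scoped Classical

variable {V : Type*} {E : Type*} [Fintype E] [DecidableEq E] [Fintype V] [DecidableEq V]
  {R : Type*} [Field R] [LinearOrder R] [IsStrictOrderedRing R]

variable (p : E → R) (ends : E → Sym2 V) (z s : V) (T : Finset V) (a b : V)

omit [LinearOrder R] [IsStrictOrderedRing R] in
/-- **The mixed terms average the gates**: for `s ≠ z`, `z ∉ T`,
`P_p(delEvent z A ∩ R_T) = Σ_W P_p(N(z) = W) · P_{pinZ p}(A ∩ gateEvent s T W W)`. -/
theorem prob_delEvent_inter_avoid_eq_sum (hs : s ≠ z) (hT : z ∉ T) (A : Set (Config E)) :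
    prob p (delEvent ends z A ∩ avoidAll ends s T) =
      ∑ W : Finset V, prob p (nbhdEvent ends z W) *
        prob (pinZ p ends z) (A ∩ Gate.gateEvent ends s T W W) := by
  rw [prob_eq_sum_nbhdEvent p ends z]
  refine Finset.sum_congr rfl fun W _ => ?_
  have e : delEvent ends z A ∩ avoidAll ends s T ∩ nbhdEvent ends z W =
      delEvent ends z (A ∩ Gate.gateEvent ends s T W W) ∩ nbhdEvent ends z W := by
    ext ω
    simp only [Set.mem_inter_iff, delEvent, Set.mem_setOf_eq, nbhdEvent]
    constructor
    · rintro ⟨⟨hA, hR⟩, hW⟩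
      refine ⟨⟨hA, ?_⟩, hW⟩
      have h := (mem_avoidAll_iff_del_gateEvent ends z hs hT ω).1 hR
      rwa [hW] at h
    · rintro ⟨⟨hA, hG⟩, hW⟩
      refine ⟨⟨hA, ?_⟩, hW⟩
      rw [mem_avoidAll_iff_del_gateEvent ends z hs hT, hW]
      exact hG
  rw [e, prob_delEvent_inter_nbhdEvent, prob_pinZ_eq, mul_comm]

omit [LinearOrder R] [IsStrictOrderedRing R] in
/-- The `G`-avoidance itself averages the gates. -/
theorem prob_avoid_eq_sum (hs : s ≠ z) (hT : z ∉ T) :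
    prob p (avoidAll ends s T) =
      ∑ W : Finset V, prob p (nbhdEvent ends z W) *
        prob (pinZ p ends z) (Gate.gateEvent ends s T W W) := by
  have h := prob_delEvent_inter_avoid_eq_sum p ends z s T hs hT Set.univ
  have e1 : delEvent ends z (Set.univ : Set (Config E)) = Set.univ := by
    ext ω; simp [delEvent]
  rw [e1, Set.univ_inter] at h
  rw [h]
  refine Finset.sum_congr rfl fun W _ => ?_
  rw [Set.univ_inter]

/-- **(VTX) from the gates of `H`**: if `GateRow (pinZ p) s T a b W W` holds for every `W`, then
`VTX p ends z s T a b` (for `s ≠ z`, `z ∉ T`). -/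
theorem VTX_of_gateRow (hp : IsProbVec p) (hs : s ≠ z) (hT : z ∉ T)
    (hG : ∀ W : Finset V, Gate.GateRow (pinZ p ends z) ends s T a b W W) :
    VTX p ends z s T a b := by
  unfold VTX
  rw [← prob_pinZ_eq, ← prob_pinZ_eq, ← prob_pinZ_eq,
    prob_delEvent_inter_avoid_eq_sum p ends z s T hs hT,
    prob_delEvent_inter_avoid_eq_sum p ends z s T hs hT,
    prob_delEvent_inter_avoid_eq_sum p ends z s T hs hT, prob_avoid_eq_sum p ends z s T hs hT,
    Set.inter_comm (avoidAll ends s T) (connAll ends s {a}),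
    Set.inter_comm (avoidAll ends s T) (connAll ends s {b})]
  set q := pinZ p ends z with hq
  set r := prob q (avoidAll ends s T) with hr
  set x := prob q (connAll ends s {a} ∩ avoidAll ends s T) with hx
  set y := prob q (connAll ends s {b} ∩ avoidAll ends s T) with hy
  set n : Finset V → R := fun W => prob p (nbhdEvent ends z W) with hn
  set xy : Finset V → R := fun W =>
    prob q (connAll ends s ({a} ∪ {b}) ∩ Gate.gateEvent ends s T W W) with hxy
  set yW : Finset V → R := fun W => prob q (connAll ends s {b} ∩ Gate.gateEvent ends s T W W)
    with hyW
  set xW : Finset V → R := fun W => prob q (connAll ends s {a} ∩ Gate.gateEvent ends s T W W)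
    with hxW
  set g : Finset V → R := fun W => prob q (Gate.gateEvent ends s T W W) with hg
  -- the summed expression is the sum of the gate expressions
  have hsum : (∑ W : Finset V, n W * (r ^ 2 * xy W - r * (x * yW W + y * xW W) + x * y * g W)) =
      r ^ 2 * (∑ W : Finset V, n W * xy W) -
        r * (x * (∑ W : Finset V, n W * yW W) + y * (∑ W : Finset V, n W * xW W)) +
        x * y * (∑ W : Finset V, n W * g W) := by
    simp only [Finset.mul_sum, mul_add, ← Finset.sum_add_distrib, ← Finset.sum_sub_distrib]
    refine Finset.sum_congr rfl fun W _ => ?_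
    ring
  rw [← hsum]
  refine Finset.sum_nonneg fun W _ => mul_nonneg (prob_nonneg hp _) ?_
  have h := hG W
  unfold Gate.GateRow at h
  exact h

/-- **(VTX) from (CON-W)**: the non-degenerate `W` are `ConW` (at any representative), the
degenerate ones are Lemma A / Lemma A′ / the empty gate. -/
theorem VTX_of_ConW (hp : IsProbVec p) (hs : s ≠ z) (hT : z ∉ T)
    (hC : ∀ (W : Finset V) (w₀ : V), s ∉ W → (∀ t ∈ T, t ∉ W) → w₀ ∈ W →
      Contract.ConW (pinZ p ends z) ends s T W w₀ a b) :
    VTX p ends z s T a b := by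
  have hq : IsProbVec (pinZ p ends z) := isProbVec_pinZ p ends z hp
  refine VTX_of_gateRow p ends z s T a b hp hs hT fun W => ?_
  by_cases hsW : s ∈ W
  · exact Gate.GateRow_of_root_mem _ ends s T a b W W hq hsW
  · by_cases hTW : ∃ t ∈ T, t ∈ W
    · obtain ⟨t, ht, htW⟩ := hTW
      exact Gate.GateRow_of_T_mem _ ends s T a b W W hq ht htW
    · simp only [not_exists, not_and] at hTW
      rcases W.eq_empty_or_nonempty with hW | ⟨w₀, hw₀⟩
      · subst hW
        exact Gate.GateRow_empty_left _ ends s T a b ∅ hq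
      · have hcon := hC W w₀ hsW hTW hw₀
        unfold Contract.ConW at hcon
        unfold Gate.GateRow
        have e : avoidAll (Contract.contractEnds ends W w₀) s T = Gate.gateEvent ends s T W W := by
          rw [Contract.avoidAll_contract_eq hw₀ hsW hTW]
          ext ω
          simp only [Gate.gateEvent, Gate.hitsS, Gate.hitsK, Set.mem_inter_iff, Set.mem_setOf_eq,
            Set.mem_compl_iff]
          constructor
          · rintro ⟨hR, h⟩
            exact ⟨hR, fun ⟨hS, w, hw, t, ht, hc⟩ => h ⟨hS, w, hw, t, ht, conn_symm hc⟩⟩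
          · rintro ⟨hR, h⟩
            exact ⟨hR, fun ⟨hS, w, hw, t, ht, hc⟩ => h ⟨hS, w, hw, t, ht, conn_symm hc⟩⟩
        rw [e] at hcon
        exact hcon

omit [Fintype E] [DecidableEq E] [Fintype V] [DecidableEq V] in
/-- **`ConW_all → VTX_all`.** -/
theorem VTX_all_of_ConW_all (h : Contract.ConW_all R) : VTX_all R := by
  intro V E _ _ _ _ ends p hp z s T a b hs hT hsT
  exact VTX_of_ConW p ends z s T a b hp hs hT
    (fun W w₀ hsW hTW hw₀ => h V E ends (pinZ p ends z) (isProbVec_pinZ p ends z hp) s T W w₀ a b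
      hsT hsW hTW hw₀)

end NewVertex

end Summit.Ventures.PercRepro2
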